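import Mathlib

/-!
# `MatrixDescartes` census — the ROOT-COUNT LIMIT LEMMA («continuity of roots» inside a compact interval)

HONEST FRAMING.  Object-search cell `pub-symmetroid`, crux `Theses.LacunarySymmetroid.MatrixDescartes`
(stmt-ValiantsHypothesis-18050); this file is a HELPER of that item with no closure claim.  It supplies, as a kernel
theorem about arbitrary real polynomials, the analytic input «continuity of roots + Descartes» of the theory seat's
RESIDUE-READING note §2(f)/(k)/(l) (theory g20, 2026-08-25; typer duty W1 of the desk's ruling R1260): if `P n → p`
COEFFICIENTWISE with degrees `≤ D`, `p ≠ 0`, and every `P n` has `M` DISTINCT roots in a compact interval `[α, β]`, then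
`p` has at least `M` roots in `[α, β]` COUNTED WITH MULTIPLICITY (`card_roots_ge_of_coeff_tendsto`, and the
`roots.toFinset.filter` form `card_roots_ge_of_coeff_tendsto'`).  In the V = 20 programme for
`DoorA26 = PosRootLawAt 2 6 19` (OPEN, never asserted) this is the step «a limit of twenties whose seventeen large roots
stay in a compact subinterval of `(0, ∞)` is a form with `≥ 17` positive roots counted with multiplicity», to which the
with-multiplicity window rows (`Census.newton_window_support`, …CensusWindowNSupport) apply; the compactness of the
large roots along the sequence is NOT proved here and is exactly the located input the note names.  Nothing bounds `ζ`;
nothing bears on `MatrixDescartes` or on `VP ≠ VNP`.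

Contents (all PROVED, Mathlib only): `rolle_chain` (Rolle between consecutive distinct roots, interlacing chain),
`rolle_iterate` (`n` distinct roots ⇒ `n − j` distinct roots of `p^{(j)}` in the same interval), `natDegree_le_of_coeff_tendsto`,
`eval_tendsto_of_coeff_tendsto` (values converge along convergent points), `iterate_derivative_natDegree_le`,
`iterate_derivative_coeff_tendsto` (the hypotheses pass to derivatives), `card_roots_filter_ge_of_fibres` (counting with
`rootMultiplicity`), and the two forms of the limit lemma (Bolzano–Weierstrass on the sorted root vectors in `Fin M → ℝ`,
Rolle chains inside each cluster of merging roots, `p^{(j)}(v) = lim P_{φ n}^{(j)}(ξ_n) = 0` for `j <` cluster size,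
`Polynomial.lt_rootMultiplicity_iff_isRoot_iterate_derivative`).

[folklore] Elementary real analysis; no citation exists or is needed.
-/

-- `Summit.ValiantsHypothesis.ValiantsHypothesis.…` repeats a component by the D-0017 layout
-- (single-conjunct summit), which the `dupNamespace` linter flags; the name is mandated.
set_option linter.dupNamespace false

open Polynomial Filter Topology Finset

namespace Summit.ValiantsHypothesis.ValiantsHypothesis.Theorems.LacunarySymmetroidMatrixDescartes.Census

/-! ## 1. Rolle chains -/

/-- **Rolle, chained.**  `n + 1` distinct roots `x₀ < ⋯ < x_n` of `p` give `n` roots of `p'` interlacing them. [folklore] -/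
theorem rolle_chain (p : ℝ[X]) {n : ℕ} (x : Fin (n + 1) → ℝ) (hx : StrictMono x)
    (hroot : ∀ i, p.IsRoot (x i)) :
    ∃ y : Fin n → ℝ, StrictMono y ∧ (∀ i : Fin n, x i.castSucc < y i ∧ y i < x i.succ) ∧
      ∀ i, (derivative p).IsRoot (y i) := by
  have h : ∀ i : Fin n, ∃ c ∈ Set.Ioo (x i.castSucc) (x i.succ), (derivative p).IsRoot c := by
    intro i
    have hlt : x i.castSucc < x i.succ := hx (by exact Fin.castSucc_lt_succ)
    have hfa : (fun t => p.eval t) (x i.castSucc) = (fun t => p.eval t) (x i.succ) := by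
      simp only [(hroot _).eq_zero]
    obtain ⟨c, hc, hdc⟩ := exists_deriv_eq_zero hlt p.continuous.continuousOn hfa
    refine ⟨c, hc, ?_⟩
    rw [Polynomial.deriv] at hdc
    exact hdc
  choose y hy hyr using h
  refine ⟨y, ?_, hy, hyr⟩
  intro i j hij
  calc y i < x i.succ := (hy i).2
    _ ≤ x j.castSucc := hx.monotone (by
        rw [Fin.le_def]; simp only [Fin.val_succ, Fin.val_castSucc]; exact hij)
    _ < y j := (hy j).1

/-- **Rolle, iterated.**  `n` distinct roots of `p` in increasing order give, for every `j ≤ n`, `n - j` distinct roots of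
`p^{(j)}` inside `[x₀, x_{n-1}]`. [folklore] -/
theorem rolle_iterate (j : ℕ) : ∀ (n : ℕ) (p : ℝ[X]) (x : Fin n → ℝ), StrictMono x → (∀ i, p.IsRoot (x i)) →
    ∀ lo hi : ℝ, (∀ i, lo ≤ x i ∧ x i ≤ hi) →
    ∃ y : Fin (n - j) → ℝ, StrictMono y ∧ (∀ i, lo ≤ y i ∧ y i ≤ hi) ∧
      ∀ i, (derivative^[j] p).IsRoot (y i) := by
  induction j with
  | zero =>
    intro n p x hx hroot lo hi hbd
    exact ⟨x, hx, hbd, by simpa using hroot⟩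
  | succ j ih =>
    intro n p x hx hroot lo hi hbd
    cases n with
    | zero =>
      exact ⟨fun i => absurd i.2 (by omega), fun i => absurd i.2 (by omega), fun i => absurd i.2 (by omega),
        fun i => absurd i.2 (by omega)⟩
    | succ n =>
      obtain ⟨y, hy, hyb, hyr⟩ := rolle_chain p x hx hroot
      have hbd' : ∀ i, lo ≤ y i ∧ y i ≤ hi := fun i =>
        ⟨(hbd _).1.trans (hyb i).1.le, (hyb i).2.le.trans (hbd _).2⟩
      obtain ⟨z, hz, hzb, hzr⟩ := ih n (derivative p) y hy hyr lo hi hbd'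
      refine ⟨fun i => z (Fin.cast (by omega) i),
        fun a b hab => hz (by rw [Fin.lt_def, Fin.val_cast, Fin.val_cast]; exact hab),
        fun i => hzb _, fun i => ?_⟩
      rw [Function.iterate_succ_apply]
      exact hzr _


/-! ## 2. Coefficientwise convergence ⇒ convergence of values (and of all derivatives) -/

/-- A coefficientwise limit of polynomials of degree `≤ D` has degree `≤ D`. [folklore] -/
theorem natDegree_le_of_coeff_tendsto {D : ℕ} {P : ℕ → ℝ[X]} {p : ℝ[X]} (hdeg : ∀ n, (P n).natDegree ≤ D)
    (hcoef : ∀ k, Tendsto (fun n => (P n).coeff k) atTop (𝓝 (p.coeff k))) : p.natDegree ≤ D := by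
  rw [natDegree_le_iff_coeff_eq_zero]
  intro k hk
  have h0 : (fun n => (P n).coeff k) = fun _ => (0 : ℝ) := by
    funext n
    exact coeff_eq_zero_of_natDegree_lt (lt_of_le_of_lt (hdeg n) (by exact_mod_cast hk))
  have := hcoef k
  rw [h0] at this
  exact tendsto_nhds_unique this tendsto_const_nhds

/-- Coefficientwise convergence with bounded degree gives convergence of values along any convergent sequence of
points. [folklore] -/
theorem eval_tendsto_of_coeff_tendsto {D : ℕ} {P : ℕ → ℝ[X]} {p : ℝ[X]} (hdeg : ∀ n, (P n).natDegree ≤ D)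
    (hcoef : ∀ k, Tendsto (fun n => (P n).coeff k) atTop (𝓝 (p.coeff k)))
    {x : ℕ → ℝ} {x₀ : ℝ} (hx : Tendsto x atTop (𝓝 x₀)) :
    Tendsto (fun n => (P n).eval (x n)) atTop (𝓝 (p.eval x₀)) := by
  have hp : p.natDegree ≤ D := natDegree_le_of_coeff_tendsto hdeg hcoef
  have h1 : ∀ n, (P n).eval (x n) = ∑ k ∈ range (D + 1), (P n).coeff k * (x n) ^ k :=
    fun n => eval_eq_sum_range' (Nat.lt_succ_of_le (hdeg n)) _
  have h2 : p.eval x₀ = ∑ k ∈ range (D + 1), p.coeff k * x₀ ^ k := eval_eq_sum_range' (Nat.lt_succ_of_le hp) _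
  simp_rw [h1]; rw [h2]
  exact tendsto_finsetSum _ fun k _ => (hcoef k).mul (hx.pow k)

/-- The hypotheses pass to iterated derivatives. [folklore] -/
theorem iterate_derivative_natDegree_le {D : ℕ} (q : ℝ[X]) (hq : q.natDegree ≤ D) (j : ℕ) :
    (derivative^[j] q).natDegree ≤ D := by
  induction j with
  | zero => simpa using hq
  | succ j ih =>
    rw [Function.iterate_succ_apply']
    exact (natDegree_derivative_le _).trans ((Nat.sub_le _ _).trans ih)

/-- coefficientwise convergence passes to iterated derivatives. [folklore] -/
theorem iterate_derivative_coeff_tendsto {P : ℕ → ℝ[X]} {p : ℝ[X]}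
    (hcoef : ∀ k, Tendsto (fun n => (P n).coeff k) atTop (𝓝 (p.coeff k))) (j k : ℕ) :
    Tendsto (fun n => (derivative^[j] (P n)).coeff k) atTop (𝓝 ((derivative^[j] p).coeff k)) := by
  simp_rw [coeff_iterate_derivative, nsmul_eq_mul]
  exact (hcoef (k + j)).const_mul _


/-! ## 3. The limit lemma -/

/-- counting: if every fibre of `a : Fin M → ℝ` over its image has size at most the multiplicity of that value as a root
of `p ≠ 0`, and the image lies in `[α, β]`, then `p` has at least `M` roots in `[α, β]` counted with multiplicity.
[folklore] -/
theorem card_roots_filter_ge_of_fibres {M : ℕ} {α β : ℝ} {p : ℝ[X]} (hp : p ≠ 0) (a : Fin M → ℝ)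
    (hab : ∀ i, α ≤ a i ∧ a i ≤ β)
    (hmult : ∀ v, (univ.filter (fun i => a i = v)).card ≤ p.rootMultiplicity v) :
    M ≤ Multiset.card (p.roots.filter (fun t => α ≤ t ∧ t ≤ β)) := by
  classical
  set m := p.roots.filter (fun t => α ≤ t ∧ t ≤ β) with hm
  have h1 : M = ∑ v ∈ univ.image a, (univ.filter (fun i => a i = v)).card := by
    rw [← card_eq_sum_card_image a univ]; simp
  have h2 : ∀ v ∈ univ.image a, (univ.filter (fun i => a i = v)).card ≤ m.count v := by
    intro v hv
    obtain ⟨i, -, rfl⟩ := mem_image.mp hv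
    rw [hm, Multiset.count_filter_of_pos (p := fun t => α ≤ t ∧ t ≤ β) (hab i), count_roots]
    exact hmult _
  have h3 : univ.image a ⊆ m.toFinset := by
    intro v hv
    obtain ⟨i, -, rfl⟩ := mem_image.mp hv
    have hpos : 0 < (univ.filter (fun k => a k = a i)).card :=
      card_pos.mpr ⟨i, by simp⟩
    have hroot : p.IsRoot (a i) := by
      have := lt_of_lt_of_le hpos (hmult (a i))
      exact (rootMultiplicity_pos hp).mp this
    rw [Multiset.mem_toFinset, hm, Multiset.mem_filter]
    exact ⟨(mem_roots hp).mpr hroot, hab i⟩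
  calc M = ∑ v ∈ univ.image a, (univ.filter (fun i => a i = v)).card := h1
    _ ≤ ∑ v ∈ univ.image a, m.count v := sum_le_sum h2
    _ ≤ ∑ v ∈ m.toFinset, m.count v := sum_le_sum_of_subset_of_nonneg h3 (fun _ _ _ => Nat.zero_le _)
    _ = Multiset.card m := Multiset.toFinset_sum_count_eq m

/-- **ROOT-COUNT LIMIT LEMMA** (the «continuity of roots» input of RESIDUE-READING §2(f)).  Let `P n → p` coefficientwise
with degrees `≤ D` and `p ≠ 0`, and suppose every `P n` has `M` DISTINCT roots in `[α, β]`.  Then `p` has at least `M`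
roots in `[α, β]` COUNTED WITH MULTIPLICITY (clusters of merging roots become multiple roots; nothing is lost inside a
compact interval).  Proof: Bolzano–Weierstrass on the sorted root vectors, Rolle chains inside each cluster, and
`p^{(j)}(v) = lim P_n^{(j)}(ξ_n) = 0`. [folklore] -/
theorem card_roots_ge_of_coeff_tendsto {D M : ℕ} {α β : ℝ} {P : ℕ → ℝ[X]} {p : ℝ[X]} (hp : p ≠ 0)
    (hdeg : ∀ n, (P n).natDegree ≤ D)
    (hcoef : ∀ k, Tendsto (fun n => (P n).coeff k) atTop (𝓝 (p.coeff k)))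
    (hM : ∀ n, ∃ r : Fin M → ℝ, StrictMono r ∧ ∀ i, α ≤ r i ∧ r i ≤ β ∧ (P n).IsRoot (r i)) :
    M ≤ Multiset.card (p.roots.filter (fun t => α ≤ t ∧ t ≤ β)) := by
  classical
  choose R hRmono hR using hM
  -- Bolzano–Weierstrass in `Fin M → ℝ`
  have hbd : Bornology.IsBounded (Set.Icc (fun _ : Fin M => α) (fun _ => β)) := Metric.isBounded_Icc _ _
  have hmem : ∀ n, R n ∈ Set.Icc (fun _ : Fin M => α) (fun _ => β) :=
    fun n => ⟨fun i => (hR n i).1, fun i => (hR n i).2.1⟩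
  obtain ⟨a, -, φ, hφ, hlim⟩ := tendsto_subseq_of_bounded hbd hmem
  have hci : ∀ i, Tendsto (fun n => R (φ n) i) atTop (𝓝 (a i)) := fun i => tendsto_pi_nhds.mp hlim i
  have haα : ∀ i, α ≤ a i := fun i => ge_of_tendsto' (hci i) (fun n => (hR _ i).1)
  have haβ : ∀ i, a i ≤ β := fun i => le_of_tendsto' (hci i) (fun n => (hR _ i).2.1)
  -- the subsequence keeps the hypotheses
  have hdeg' : ∀ n, (P (φ n)).natDegree ≤ D := fun n => hdeg _
  have hcoef' : ∀ k, Tendsto (fun n => (P (φ n)).coeff k) atTop (𝓝 (p.coeff k)) :=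
    fun k => (hcoef k).comp hφ.tendsto_atTop
  refine card_roots_filter_ge_of_fibres hp a (fun i => ⟨haα i, haβ i⟩) ?_
  intro v
  set μ := (univ.filter (fun i => a i = v)).card with hμ
  rcases Nat.eq_zero_or_pos μ with h0 | hpos
  · rw [h0]; exact Nat.zero_le _
  -- every derivative of order `< μ` vanishes at `v`
  have key : ∀ j, j < μ → (derivative^[j] p).IsRoot v := by
    intro j hj
    let e : Fin μ ↪o Fin M := (univ.filter (fun i => a i = v)).orderEmbOfFin hμ.symm
    have he : ∀ t, a (e t) = v := by
      intro t
      have := (univ.filter (fun i => a i = v)).orderEmbOfFin_mem hμ.symm t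
      exact (mem_filter.mp this).2
    set t0 : Fin μ := ⟨0, hpos⟩
    set t1 : Fin μ := ⟨μ - 1, by omega⟩
    have hchain : ∀ n, ∃ ξ : ℝ, R (φ n) (e t0) ≤ ξ ∧ ξ ≤ R (φ n) (e t1) ∧
        (derivative^[j] (P (φ n))).IsRoot ξ := by
      intro n
      obtain ⟨y, -, hyb, hyr⟩ := rolle_iterate j μ (P (φ n)) (fun t => R (φ n) (e t))
        (fun s t hst => hRmono _ (e.strictMono hst)) (fun t => (hR _ _).2.2)
        (R (φ n) (e t0)) (R (φ n) (e t1))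
        (fun t => ⟨(hRmono _).monotone (e.monotone (by rw [Fin.le_def]; exact Nat.zero_le _)),
          (hRmono _).monotone (e.monotone (by rw [Fin.le_def]; simp [t1]; omega))⟩)
      exact ⟨y ⟨0, by omega⟩, (hyb _).1, (hyb _).2, hyr _⟩
    choose ξ hξlo hξhi hξr using hchain
    have hlo : Tendsto (fun n => R (φ n) (e t0)) atTop (𝓝 v) := by rw [← he t0]; exact hci _
    have hhi : Tendsto (fun n => R (φ n) (e t1)) atTop (𝓝 v) := by rw [← he t1]; exact hci _
    have hξ : Tendsto ξ atTop (𝓝 v) := tendsto_of_tendsto_of_tendsto_of_le_of_le hlo hhi hξlo hξhi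
    have hev := eval_tendsto_of_coeff_tendsto (fun n => iterate_derivative_natDegree_le _ (hdeg' n) j)
      (fun k => iterate_derivative_coeff_tendsto hcoef' j k) hξ
    have h0 : (fun n => (derivative^[j] (P (φ n))).eval (ξ n)) = fun _ => (0 : ℝ) :=
      funext fun n => (hξr n).eq_zero
    rw [h0] at hev
    exact tendsto_nhds_unique hev tendsto_const_nhds
  have := (lt_rootMultiplicity_iff_isRoot_iterate_derivative (n := μ - 1) hp).mpr
    (fun m hm => key m (by omega))
  omega


/-- **ROOT-COUNT LIMIT LEMMA, counting form.**  Same as `card_roots_ge_of_coeff_tendsto` with the hypothesis stated as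
«at least `M` distinct roots of `P n` in `[α, β]`» in the `roots.toFinset.filter` currency of the census files. [folklore] -/
theorem card_roots_ge_of_coeff_tendsto' {D M : ℕ} {α β : ℝ} {P : ℕ → ℝ[X]} {p : ℝ[X]} (hp : p ≠ 0)
    (hdeg : ∀ n, (P n).natDegree ≤ D)
    (hcoef : ∀ k, Tendsto (fun n => (P n).coeff k) atTop (𝓝 (p.coeff k)))
    (hM : ∀ n, M ≤ (((P n).roots.toFinset).filter (fun t => α ≤ t ∧ t ≤ β)).card) :
    M ≤ Multiset.card (p.roots.filter (fun t => α ≤ t ∧ t ≤ β)) := by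
  classical
  refine card_roots_ge_of_coeff_tendsto hp hdeg hcoef fun n => ?_
  obtain ⟨s, hs, hcard⟩ := exists_subset_card_eq (hM n)
  refine ⟨fun i => s.orderEmbOfFin hcard i, (s.orderEmbOfFin hcard).strictMono, fun i => ?_⟩
  have hi : s.orderEmbOfFin hcard i ∈ ((P n).roots.toFinset).filter (fun t => α ≤ t ∧ t ≤ β) :=
    hs (s.orderEmbOfFin_mem hcard i)
  rw [mem_filter, Multiset.mem_toFinset] at hi
  exact ⟨hi.2.1, hi.2.2, (mem_roots'.mp hi.1).2⟩

end Summit.ValiantsHypothesis.ValiantsHypothesis.Theorems.LacunarySymmetroidMatrixDescartes.Census
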